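import Literature.NumberTheory.EllipticCurves.JZeroGoodReductionTwoTraceProofs
import HarnessLib

/-!
# The trace of Frobenius at `2` from the minimal equation: `a₂ ∈ {0}, {±1}, {±2}` according as `32 ∣ c₄`, `2 ∤ c₄`, `2⁴ ∥ c₄`

Topic `NumberTheory/EllipticCurves`; THEOREMS ONLY (no definition, no named fact, no instance). Sequel of
`JZeroGoodReductionTwoTraceProofs` (the case `c₄ = 0`, i.e. `j = 0`) and of `ReductionAtTwoJValuationWindow`
(good reduction at `2` forces `v₂(j) = 0` or `v₂(j) ≥ 12`), sharpened to the TRACE: for a globally minimal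
`W/ℚ` with good reduction at `2` (so `Δ_min` is odd and `j = c₄³/Δ_min` has `v₂(j) = 3·v₂(c₄)`),

* `2 ∤ c₄` (`⟺ a₁` odd `⟺ v₂(j) = 0`): the reduction `y² + xy + a₃y = …` has a rational point of order `2`, `#W̃(𝔽₂) ∈ {2, 4}`,
  **`a₂ = ±1`** (ordinary) — `natAbs_frobeniusTrace_two_eq_one_of_not_two_dvd_c₄`;
* `2 ∣ c₄` forces `a₁ = 2α` even and `c₄ = 16((α² + a₂)² − 3(a₄ + αa₃))`, `a₃` odd (`Δ ≡ a₃⁴`); then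
  `a₂ ≡ a₄ (mod 2) ⟺ 32 ∣ c₄`, and the reduction `y² + y = x³ + āx² + b̄x + c̄` has `3` points if `ā = b̄` and `1` or `5`
  points otherwise: **`32 ∣ c₄ ⟹ a₂ = 0`** (`frobeniusTrace_two_eq_zero_of_dvd_c₄`), **`2⁴ ∥ c₄ ⟹ a₂ = ±2`**
  (`natAbs_frobeniusTrace_two_eq_two`); altogether **`a₂ = 0 ⟺ 32 ∣ c₄(W_min)`** (`frobeniusTrace_two_eq_zero_iff`);
* `j`-form: `W.j = n ∈ ℤ` with `2¹⁵ ∣ n` (this includes `j = 0`) `⟹ a₂ = 0` (`frobeniusTrace_two_eq_zero_of_j_eq_intCast`);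
* ★ CM corollary `frobeniusTrace_two_eq_zero_of_j_mem_inertTwoCMJ`: the seven rational CM `j`-invariants whose order has
  `2` INERT (`d ∈ {−3, −27, −11, −19, −43, −67, −163}`, `d ≡ 5 (mod 8)`; `j ∈ {0, −2¹⁵·3·5³, −2¹⁵, −2¹⁵·3³, −2¹⁸·3³·5³,
  −2¹⁵·3³·5³·11³, −2¹⁸·3³·5³·23³·29³}`) all have `2¹⁵ ∣ j`, so **every such curve with good reduction at `2` has `a₂ = 0`**
  — Deuring's vanishing `a_p = 0` at the inert prime `p = 2`, model-free and without Deuring's theorem (the tree's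
  pointwise Deuring files exclude `p = 2`: short normal forms need `2` invertible).

All statements are elementary consequences of the formulas for `b₂, b₄, c₄, Δ` (Silverman, *AEC*, III.1), of
`j = a₁¹²/Δ` in characteristic `2` (App. A Prop. 1.1(c), Ex. 5.7) and of `a = q + 1 − #E(𝔽_q)` (V.2), read on the tree's
`integralModelInt` / `reductionPointCount` / `frobeniusTrace` (`GlobalMinimalModel`) and `LFunction_apply_prime_eq_frobeniusTrace`.

## References

* J. H. Silverman, *The Arithmetic of Elliptic Curves*, 2nd ed., GTM 106 (2009): III.1, App. A Prop. 1.1(c), Exercise 5.7,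
  V.2, VII.5 Prop. 5.1(a), App. C §11 (CM `j`-invariants). [SilvermanAEC2009]
* A. Kraus, *Quelques remarques à propos des invariants c₄, c₆ et Δ d'une courbe elliptique*, Acta Arith. 54 (1989),
  Prop. 2 (the `2`-adic congruences on `c₄`). [Kraus1989]

## Mathlib / tree search

Mathlib: `WeierstrassCurve.c₄_of_char_two`, `Δ_of_char_two`, `map_c₄`, `map_Δ`, `@[simps] map`, `WeierstrassCurve.j`,
`coe_Δ'`, `Int.pow_dvd_pow_iff`, `ZMod.intCast_zmod_eq_zero_iff_dvd`. Tree: `JZero.two_dvd_a₁_of_c₄_eq_zero` /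
`sq_eq_three_mul_of_c₄_eq_zero` (the `c₄ = 0` versions), `JZero.intCast_a₃_eq_one_of_two_dvd_a₁`,
`JZero.natCard_point_eq_three`, `JZero.not_two_dvd_minimalDiscriminantInt` (`JZeroGoodReductionTwoTraceProofs`);
`DeuringHasse.natCard_point_eq_card_filter_add_one`; `ReductionAtTwoJValuationWindow` (`v₂(j) ∈ {0} ∪ [12, ∞)`, not
imported: heavier closure); `cmJInvariants` / `maximalCMJInvariants` (not needed: the seven values are listed).
-/

noncomputable section

open scoped Classical

open WeierstrassCurve Finset

namespace Literature.NumberTheory.EllipticCurves.TraceAtTwo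

/-! ### §1 Integer arithmetic of `c₄` modulo powers of `2` -/

/-- `(a : ℤ/2) = 0 ⟺ 2 ∣ a` with the integer literal `2`. [cite: SilvermanAEC2009, III.1] -/
private theorem intCast_zmod_two_eq_zero_iff (a : ℤ) : ((a : ZMod 2) = 0) ↔ (2 : ℤ) ∣ a := by
  exact_mod_cast ZMod.intCast_zmod_eq_zero_iff_dvd a 2

/-- **`2 ∣ c₄ ⟺ 2 ∣ a₁`** for a Weierstrass equation over `ℤ` (`c₄ ≡ a₁⁴ (mod 2)`, Mathlib `c₄_of_char_two`).
[cite: SilvermanAEC2009, III.1 (c₄ = b₂² − 24 b₄) and App. A Prop. 1.1(c)] -/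
theorem two_dvd_c₄_iff_two_dvd_a₁ (V : WeierstrassCurve ℤ) : (2 : ℤ) ∣ V.c₄ ↔ (2 : ℤ) ∣ V.a₁ := by
  set E : WeierstrassCurve (ZMod 2) := V.map (Int.castRingHom (ZMod 2)) with hE
  have hc : ((V.c₄ : ℤ) : ZMod 2) = ((V.a₁ : ℤ) : ZMod 2) ^ 4 := by
    have h := c₄_of_char_two E
    rw [hE, map_c₄] at h
    simpa [hE] using h
  rw [← intCast_zmod_two_eq_zero_iff, ← intCast_zmod_two_eq_zero_iff, hc]
  constructor
  · exact fun h => pow_eq_zero_iff (by norm_num) |>.mp h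
  · intro h; rw [h]; ring

/-- **`a₁ = 2α ⟹ c₄ = 16((α² + a₂)² − 3(a₄ + αa₃))`** (`b₂ = 4(α² + a₂)`, `b₄ = 2(a₄ + αa₃)`).
[cite: SilvermanAEC2009, III.1 (b₂, b₄, c₄)] -/
theorem c₄_eq_sixteen_mul (V : WeierstrassCurve ℤ) {α : ℤ} (hα : V.a₁ = 2 * α) :
    V.c₄ = 16 * ((α ^ 2 + V.a₂) ^ 2 - 3 * (V.a₄ + α * V.a₃)) := by
  simp only [WeierstrassCurve.c₄, WeierstrassCurve.b₂, WeierstrassCurve.b₄, hα]; ring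

/-- **`2 ∣ c₄ ⟹ 16 ∣ c₄`** over `ℤ` (Kraus's congruence: `c₄` is odd or divisible by `16`).
[cite: Kraus1989, Prop. 2] -/
theorem sixteen_dvd_c₄_of_two_dvd_c₄ (V : WeierstrassCurve ℤ) (h : (2 : ℤ) ∣ V.c₄) : (16 : ℤ) ∣ V.c₄ := by
  obtain ⟨α, hα⟩ := (two_dvd_c₄_iff_two_dvd_a₁ V).mp h
  exact ⟨_, c₄_eq_sixteen_mul V hα⟩

/-- **With `a₁` even and `Δ` odd: `a₂ ≡ a₄ (mod 2) ⟺ 32 ∣ c₄`.** Writing `a₁ = 2α`, `c₄/16 = (α² + a₂)² − 3(a₄ + αa₃)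
≡ α + a₂ + a₄ + α ≡ a₂ + a₄ (mod 2)` since `a₃` is odd. [cite: SilvermanAEC2009, III.1 (c₄) and App. A Prop. 1.1(c)] -/
theorem intCast_a₂_eq_intCast_a₄_iff_dvd_c₄ (V : WeierstrassCurve ℤ) (h1 : (2 : ℤ) ∣ V.a₁)
    (hΔ : ¬ (2 : ℤ) ∣ V.Δ) : ((V.a₂ : ℤ) : ZMod 2) = ((V.a₄ : ℤ) : ZMod 2) ↔ (32 : ℤ) ∣ V.c₄ := by
  obtain ⟨α, hα⟩ := h1
  have h3 := JZero.intCast_a₃_eq_one_of_two_dvd_a₁ V ⟨α, hα⟩ hΔ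
  have hc := c₄_eq_sixteen_mul V hα
  -- `32 ∣ 16 t ⟺ 2 ∣ t`
  have h32 : (32 : ℤ) ∣ V.c₄ ↔ (2 : ℤ) ∣ ((α ^ 2 + V.a₂) ^ 2 - 3 * (V.a₄ + α * V.a₃)) := by
    rw [hc, show (32 : ℤ) = 16 * 2 by norm_num]
    exact Int.mul_dvd_mul_iff_left (by norm_num)
  rw [h32, ← intCast_zmod_two_eq_zero_iff]
  push_cast
  rw [h3]
  generalize ((α : ℤ) : ZMod 2) = x
  generalize ((V.a₂ : ℤ) : ZMod 2) = a
  generalize ((V.a₄ : ℤ) : ZMod 2) = b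
  decide +revert

/-! ### §2 Point counts over `𝔽₂` -/

/-- **`a₁ = 0`, `a₃ = 1`, `a₂ ≠ a₄` over `𝔽₂`: `#E(𝔽₂) = 5` or `1`** (the right-hand side of `y² + y = x³ + ax² + bx + c`,
`a ≠ b`, takes the same value `c` at `x = 0, 1`: four affine points if `c = 0`, none if `c = 1`).
[cite: SilvermanAEC2009, V.2 and Exercise 5.7] -/
theorem natCard_point_eq_five_or_one (E : WeierstrassCurve (ZMod 2)) [E.IsElliptic] (h1 : E.a₁ = 0)
    (h3 : E.a₃ = 1) (h24 : E.a₂ ≠ E.a₄) : Nat.card E.toAffine.Point = 5 ∨ Nat.card E.toAffine.Point = 1 := by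
  rw [DeuringHasse.natCard_point_eq_card_filter_add_one E, h1, h3]
  revert h24
  generalize E.a₂ = a
  generalize E.a₄ = b
  generalize E.a₆ = c
  decide +revert

/-- **`a₁ = 1` over `𝔽₂`: `#E(𝔽₂) = 2` or `4`** (for `y² + xy + a₃y = x³ + a₂x² + a₄x + a₆` exactly one of the fibres
`x = 0`, `x = 1` is a quadratic `y² + y = ·` with `0` or `2` solutions and the other is `y² = ·` with one: the affine count is odd).
[cite: SilvermanAEC2009, V.2 and Exercise 5.7] -/
theorem natCard_point_eq_two_or_four (E : WeierstrassCurve (ZMod 2)) [E.IsElliptic] (h1 : E.a₁ = 1) :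
    Nat.card E.toAffine.Point = 2 ∨ Nat.card E.toAffine.Point = 4 := by
  rw [DeuringHasse.natCard_point_eq_card_filter_add_one E, h1]
  generalize E.a₂ = a
  generalize E.a₃ = b
  generalize E.a₄ = c
  generalize E.a₆ = d
  decide +revert

/-- Over `𝔽₂` an element is `0` or `1`. [cite: SilvermanAEC2009, V.2] -/
private theorem zmod_two_eq_zero_or_one (x : ZMod 2) : x = 0 ∨ x = 1 := by
  decide +revert

/-! ### §3 Globally minimal curves over `ℚ` with good reduction at `2` -/

variable (W : WeierstrassCurve ℚ) [W.IsGloballyMinimal]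

/-- The reduction of the minimal model modulo `2` is an elliptic curve when `W` has good reduction at `2`.
[cite: SilvermanAEC2009, VII.5 Prop. 5.1(a)] -/
theorem isElliptic_map_two (h : W.HasGoodReductionAtPrime 2) :
    ((integralModelInt W).map (Int.castRingHom (ZMod 2))).IsElliptic := by
  rw [isElliptic_iff, map_Δ, isUnit_iff_ne_zero, eq_intCast, Ne, ZMod.intCast_zmod_eq_zero_iff_dvd]
  exact JZero.not_two_dvd_minimalDiscriminantInt W h

/-- ★ **`32 ∣ c₄(W_min) ⟹ a₂(W) = 0`** for a globally minimal `W/ℚ` with good reduction at `2`: `a₁` is even, `a₃` odd,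
`a₂ ≡ a₄ (mod 2)`, and the reduction `y² + y = x³ + āx² + āx + c̄` has three `𝔽₂`-points.
[cite: SilvermanAEC2009, V.2, Exercise 5.7 and III.1] -/
theorem frobeniusTrace_two_eq_zero_of_dvd_c₄ (h : W.HasGoodReductionAtPrime 2)
    (h32 : (32 : ℤ) ∣ (integralModelInt W).c₄) : frobeniusTrace W 2 = 0 := by
  have hΔ : ¬ (2 : ℤ) ∣ (integralModelInt W).Δ := JZero.not_two_dvd_minimalDiscriminantInt W h
  have h2 : (2 : ℤ) ∣ (integralModelInt W).c₄ := (show (2 : ℤ) ∣ 32 by norm_num).trans h32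
  have h1 : (2 : ℤ) ∣ (integralModelInt W).a₁ := (two_dvd_c₄_iff_two_dvd_a₁ _).mp h2
  set E : WeierstrassCurve (ZMod 2) := (integralModelInt W).map (Int.castRingHom (ZMod 2)) with hE
  haveI : E.IsElliptic := isElliptic_map_two W h
  have hE1 : E.a₁ = 0 := by
    show (Int.castRingHom (ZMod 2)) (integralModelInt W).a₁ = 0
    rw [eq_intCast, ZMod.intCast_zmod_eq_zero_iff_dvd]; exact h1
  have hE3 : E.a₃ = 1 := by
    show (Int.castRingHom (ZMod 2)) (integralModelInt W).a₃ = 1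
    rw [eq_intCast]; exact JZero.intCast_a₃_eq_one_of_two_dvd_a₁ _ h1 hΔ
  have hE24 : E.a₂ = E.a₄ := by
    show (Int.castRingHom (ZMod 2)) (integralModelInt W).a₂ = (Int.castRingHom (ZMod 2)) (integralModelInt W).a₄
    rw [eq_intCast, eq_intCast]
    exact (intCast_a₂_eq_intCast_a₄_iff_dvd_c₄ _ h1 hΔ).mpr h32
  have hcount : reductionPointCount W 2 = 3 := JZero.natCard_point_eq_three E hE1 hE3 hE24
  rw [frobeniusTrace, hcount]; norm_num

/-- ★ **`2⁴ ∥ c₄(W_min) ⟹ a₂(W) = ±2`** for a globally minimal `W/ℚ` with good reduction at `2`: `a₁` even, `a₃` odd,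
`a₂ ≢ a₄ (mod 2)`, and the reduction has `5` or `1` points. [cite: SilvermanAEC2009, V.2, Exercise 5.7 and III.1] -/
theorem natAbs_frobeniusTrace_two_eq_two (h : W.HasGoodReductionAtPrime 2)
    (h16 : (2 : ℤ) ∣ (integralModelInt W).c₄) (h32 : ¬ (32 : ℤ) ∣ (integralModelInt W).c₄) :
    (frobeniusTrace W 2).natAbs = 2 := by
  have hΔ : ¬ (2 : ℤ) ∣ (integralModelInt W).Δ := JZero.not_two_dvd_minimalDiscriminantInt W h
  have h1 : (2 : ℤ) ∣ (integralModelInt W).a₁ := (two_dvd_c₄_iff_two_dvd_a₁ _).mp h16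
  set E : WeierstrassCurve (ZMod 2) := (integralModelInt W).map (Int.castRingHom (ZMod 2)) with hE
  haveI : E.IsElliptic := isElliptic_map_two W h
  have hE1 : E.a₁ = 0 := by
    show (Int.castRingHom (ZMod 2)) (integralModelInt W).a₁ = 0
    rw [eq_intCast, ZMod.intCast_zmod_eq_zero_iff_dvd]; exact h1
  have hE3 : E.a₃ = 1 := by
    show (Int.castRingHom (ZMod 2)) (integralModelInt W).a₃ = 1
    rw [eq_intCast]; exact JZero.intCast_a₃_eq_one_of_two_dvd_a₁ _ h1 hΔ
  have hE24 : E.a₂ ≠ E.a₄ := by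
    show (Int.castRingHom (ZMod 2)) (integralModelInt W).a₂ ≠ (Int.castRingHom (ZMod 2)) (integralModelInt W).a₄
    rw [eq_intCast, eq_intCast]
    exact fun he => h32 ((intCast_a₂_eq_intCast_a₄_iff_dvd_c₄ _ h1 hΔ).mp he)
  have hcount : reductionPointCount W 2 = 5 ∨ reductionPointCount W 2 = 1 :=
    natCard_point_eq_five_or_one E hE1 hE3 hE24
  rw [frobeniusTrace]
  rcases hcount with hc | hc <;> rw [hc] <;> norm_num

/-- ★ **`2 ∤ c₄(W_min) ⟹ a₂(W) = ±1`** (ordinary reduction at `2`) for a globally minimal `W/ℚ` with good reduction at `2`: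
`a₁` is odd, the reduction `y² + xy + a₃y = …` has `2` or `4` points. [cite: SilvermanAEC2009, V.2, Exercise 5.7 and III.1] -/
theorem natAbs_frobeniusTrace_two_eq_one_of_not_two_dvd_c₄ (h : W.HasGoodReductionAtPrime 2)
    (hodd : ¬ (2 : ℤ) ∣ (integralModelInt W).c₄) : (frobeniusTrace W 2).natAbs = 1 := by
  have h1 : ¬ (2 : ℤ) ∣ (integralModelInt W).a₁ := fun h1 => hodd ((two_dvd_c₄_iff_two_dvd_a₁ _).mpr h1)
  set E : WeierstrassCurve (ZMod 2) := (integralModelInt W).map (Int.castRingHom (ZMod 2)) with hE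
  haveI : E.IsElliptic := isElliptic_map_two W h
  have hE1 : E.a₁ = 1 := by
    have hne : E.a₁ ≠ 0 := by
      show (Int.castRingHom (ZMod 2)) (integralModelInt W).a₁ ≠ 0
      rw [eq_intCast, Ne, ZMod.intCast_zmod_eq_zero_iff_dvd]; exact h1
    exact (zmod_two_eq_zero_or_one E.a₁).resolve_left hne
  have hcount : reductionPointCount W 2 = 2 ∨ reductionPointCount W 2 = 4 := natCard_point_eq_two_or_four E hE1
  rw [frobeniusTrace]
  rcases hcount with hc | hc <;> rw [hc] <;> norm_num

/-- ★ **`a₂(W) = 0 ⟺ 32 ∣ c₄(W_min)`** for a globally minimal `W/ℚ` with good reduction at `2` (the three cases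
`2 ∤ c₄`, `2⁴ ∥ c₄`, `32 ∣ c₄` give `|a₂| = 1, 2, 0`). [cite: SilvermanAEC2009, V.2, Exercise 5.7 and III.1] -/
theorem frobeniusTrace_two_eq_zero_iff (h : W.HasGoodReductionAtPrime 2) :
    frobeniusTrace W 2 = 0 ↔ (32 : ℤ) ∣ (integralModelInt W).c₄ := by
  refine ⟨fun h0 => ?_, frobeniusTrace_two_eq_zero_of_dvd_c₄ W h⟩
  by_contra h32
  by_cases h2 : (2 : ℤ) ∣ (integralModelInt W).c₄
  · have := natAbs_frobeniusTrace_two_eq_two W h h2 h32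
    rw [h0] at this; norm_num at this
  · have := natAbs_frobeniusTrace_two_eq_one_of_not_two_dvd_c₄ W h h2
    rw [h0] at this; norm_num at this

variable [W.IsElliptic]

/-- The `L`-series coefficient: **`W.LFunction 2 = 0 ⟺ 32 ∣ c₄(W_min)`** for a globally minimal `W` good at `2`
(`c_p = t_p`, Silverman Ex. 8.19(a), tree `LFunction_apply_prime_eq_frobeniusTrace`).
[cite: SilvermanAEC2009, Exercise 8.19(a) and V.2] -/
theorem lFunction_two_eq_zero_iff (h : W.HasGoodReductionAtPrime 2) :
    W.LFunction 2 = 0 ↔ (32 : ℤ) ∣ (integralModelInt W).c₄ := by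
  rw [W.LFunction_apply_prime_eq_frobeniusTrace 2 h, frobeniusTrace_two_eq_zero_iff W h]

/-! ### §4 `j`-forms: `j = c₄³/Δ_min` with `Δ_min` odd, so `v₂(j) = 3·v₂(c₄)` -/

/-- `c₄³ = j · Δ` for the integral model of a globally minimal `W/ℚ` (`j = c₄³/Δ`, Silverman III.1), read in `ℤ` when
`j = n` is an integer. [cite: SilvermanAEC2009, III.1 (j = c₄³/Δ)] -/
theorem integralModelInt_c₄_pow_three_eq {n : ℤ} (hj : W.j = (n : ℚ)) :
    (integralModelInt W).c₄ ^ 3 = n * minimalDiscriminantInt W := by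
  have hq : W.c₄ ^ 3 = W.j * W.Δ := by
    rw [WeierstrassCurve.j, ← coe_Δ', mul_comm, ← mul_assoc, Units.mul_inv, one_mul]
  have hc : (((integralModelInt W).c₄ : ℤ) : ℚ) = W.c₄ := by
    have h := (integralModelInt W).map_c₄ (Int.castRingHom ℚ)
    rw [map_integralModelInt, eq_intCast] at h
    exact h.symm
  have h' : ((((integralModelInt W).c₄ ^ 3 : ℤ)) : ℚ) = ((n * minimalDiscriminantInt W : ℤ) : ℚ) := by
    push_cast
    rw [hc, hq, hj, cast_minimalDiscriminantInt]
  exact_mod_cast h'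

/-- ★ **`j(W) = n ∈ ℤ` with `2¹⁵ ∣ n` (in particular `j = 0`) and good reduction at `2` ⟹ `a₂(W) = 0`**:
`c₄³ = n·Δ_min` with `2¹⁵ = (2⁵)³ ∣ c₄³`, so `32 ∣ c₄`. [cite: SilvermanAEC2009, III.1 (j = c₄³/Δ) and V.2, Exercise 5.7] -/
theorem frobeniusTrace_two_eq_zero_of_j_eq_intCast (h : W.HasGoodReductionAtPrime 2) {n : ℤ} (hj : W.j = (n : ℚ))
    (hn : (2 : ℤ) ^ 15 ∣ n) : frobeniusTrace W 2 = 0 := by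
  refine frobeniusTrace_two_eq_zero_of_dvd_c₄ W h ?_
  have h3 : ((2 : ℤ) ^ 5) ^ 3 ∣ (integralModelInt W).c₄ ^ 3 := by
    rw [integralModelInt_c₄_pow_three_eq W hj, ← pow_mul]
    exact hn.mul_right _
  have := (Int.pow_dvd_pow_iff (by norm_num : 3 ≠ 0)).mp h3
  simpa using this

/-- The same for the `L`-series coefficient: `j(W) = n ∈ ℤ`, `2¹⁵ ∣ n`, good at `2` ⟹ `W.LFunction 2 = 0`.
[cite: SilvermanAEC2009, Exercise 8.19(a) and V.2] -/
theorem lFunction_two_eq_zero_of_j_eq_intCast (h : W.HasGoodReductionAtPrime 2) {n : ℤ} (hj : W.j = (n : ℚ))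
    (hn : (2 : ℤ) ^ 15 ∣ n) : W.LFunction 2 = 0 := by
  rw [W.LFunction_apply_prime_eq_frobeniusTrace 2 h, frobeniusTrace_two_eq_zero_of_j_eq_intCast W h hj hn]

/-! ### §5 ★ The CM corollary: `a₂ = 0` for every CM curve whose order has `2` inert, good at `2` -/

/-- ★ **Deuring's vanishing at the inert prime `2`, model-free.** The seven rational CM `j`-invariants whose CM order
`𝒪` has `2` INERT (`disc 𝒪 ≡ 5 (mod 8)`: `𝒪` of discriminant `−3, −27, −11, −19, −43, −67, −163`; Silverman App. C §11) are
`0, −12288000 = −2¹⁵·3·5³, −32768 = −2¹⁵, −884736 = −2¹⁵·3³, −884736000 = −2¹⁸·3³·5³, −147197952000 = −2¹⁵·3³·5³·11³,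
−262537412640768000 = −2¹⁸·3³·5³·23³·29³` — all divisible by `2¹⁵`. Hence **every elliptic curve over `ℚ` with one of these
`j`-invariants and good reduction at `2` has `a₂ = 0`** (supersingular at `2` with trace zero: there is no ideal of norm `2`
in the CM field). The remaining CM `j`-invariants either force bad reduction at `2` (`1728, 8000, 54000, 287496`:
`v₂(j) ∈ {3, 4, 6}`, tree `ReductionAtTwoJValuationWindow`) or have `2` split (`−3375, 16581375`, odd `j`: ordinary).
[cite: SilvermanAEC2009, App. C §11 (CM j-invariants) and V.2, Exercise 5.7] -/
theorem frobeniusTrace_two_eq_zero_of_j_mem_inertTwoCMJ (h : W.HasGoodReductionAtPrime 2)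
    (hj : W.j ∈ ({0, -12288000, -32768, -884736, -884736000, -147197952000, -262537412640768000} : Set ℚ)) :
    frobeniusTrace W 2 = 0 := by
  simp only [Set.mem_insert_iff, Set.mem_singleton_iff] at hj
  rcases hj with hj | hj | hj | hj | hj | hj | hj
  · exact frobeniusTrace_two_eq_zero_of_j_eq_intCast W h (n := 0) (by rw [hj]; norm_num) (dvd_zero _)
  · exact frobeniusTrace_two_eq_zero_of_j_eq_intCast W h (n := -12288000) (by rw [hj]; norm_num) (by norm_num)
  · exact frobeniusTrace_two_eq_zero_of_j_eq_intCast W h (n := -32768) (by rw [hj]; norm_num) (by norm_num)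
  · exact frobeniusTrace_two_eq_zero_of_j_eq_intCast W h (n := -884736) (by rw [hj]; norm_num) (by norm_num)
  · exact frobeniusTrace_two_eq_zero_of_j_eq_intCast W h (n := -884736000) (by rw [hj]; norm_num) (by norm_num)
  · exact frobeniusTrace_two_eq_zero_of_j_eq_intCast W h (n := -147197952000) (by rw [hj]; norm_num) (by norm_num)
  · exact frobeniusTrace_two_eq_zero_of_j_eq_intCast W h (n := -262537412640768000) (by rw [hj]; norm_num)
      (by norm_num)

/-- The `L`-series form of the CM corollary: `W.LFunction 2 = 0` for the seven inert-`2` CM `j`-invariants at a good `2`.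
[cite: SilvermanAEC2009, App. C §11 and Exercise 8.19(a)] -/
theorem lFunction_two_eq_zero_of_j_mem_inertTwoCMJ (h : W.HasGoodReductionAtPrime 2)
    (hj : W.j ∈ ({0, -12288000, -32768, -884736, -884736000, -147197952000, -262537412640768000} : Set ℚ)) :
    W.LFunction 2 = 0 := by
  rw [W.LFunction_apply_prime_eq_frobeniusTrace 2 h, frobeniusTrace_two_eq_zero_of_j_mem_inertTwoCMJ W h hj]

end Literature.NumberTheory.EllipticCurves.TraceAtTwo

end
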